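/-
Copyright (c) 2026 the pub-hodgecm-mathlib formalisation cell (harness21).  Prover seat hodgecm-mathlib-LH4-p11 (g8), req620 Track A «(D-RAM) FOUR-FRAME» squad, helper lane on
h413 = stmt-HodgeConjecture-24833 (count-neutral).  Dealer∕pen LH4-plan (g13) WORD #96 (2) «LH4-p11 OWNS THE PURE CELLS»; SIG-PureCells v1 (9a3f5135) §1 row T₃, FILE 3.  2026-09-04.
-/
import Summits.HodgeConjecture.HodgeConjecture.Theorems.F0P3cDyRamLabelledOddOneSlotKappa        -- ★ p860757 (F0P3-p01 (g36)): abstract one-slot heads `…_eq_kappaCount_mul_of_oneSlot` ∕ `…_of_oneSlot_same`; brings ★ `fibre_isCoset_zero`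
import Summits.HodgeConjecture.HodgeConjecture.Theorems.F0P3cDyRamTwoSlotLabelRead              -- ★ (LH4-p13 (g8), (L-lab-20a)): `valueClassLabel_latt_hnf_iff_normSign` (the top-A read)
import Summits.HodgeConjecture.HodgeConjecture.Theorems.F0P3cDyRamDiagonalKappaSplitCountValues   -- ★ (LH4-p04): `kappaCount_zero_latt_axis3`, `isVertexLattice_latt_axis3`; brings ★ B4 axis3 bricks, ★ non-norm dichotomy
import Summits.HodgeConjecture.HodgeConjecture.Theorems.F0P3cDyRamLabelledKappaSplitStrata        -- ★ (F0P3a-p01 (g36)): `v_le_pow_iff_of_eq`; brings ★ p859094 `latticeInLevel_diagonal_latt_T3_iff`, ★ p856661 T-strata sockets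
import Summits.HodgeConjecture.HodgeConjecture.Theorems.F0P3cDyRamLabelledOddStageAOfRecord       -- ★ p860462 (this seat): brings ★ `finite_unitTorus_orbit_of_mem_normalisedStableLattices`
import Summits.HodgeConjecture.HodgeConjecture.Theorems.F0P3cDyRamStableCountTypeZero              -- ★ (LH4-p12): `v_diag_eq_one`, `diag_regular`
import Summits.HodgeConjecture.HodgeConjecture.Theorems.F0P3cDyRamStageOneBDefs                   -- ★ DEFS №5: `mcOfRecord`; brings `mstarOfRecord`
import HarnessLib

/-!
# Crux `H413`, line LH4 «(D-RAM) FOUR-FRAME» — (β-BAL) Stage B, THE PURE STRATA, FILE 3: the third plane's on-branch stratum `T₃ = (s,s,0)`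
# `Σᶠ_{M ∈ stratum (s,s,0), clean shell} labelledOddCount σ ϖ 0 i Λ M ∕ [𝒰 : N(S̃′(M))] = [s + ℓ₀ = n₃ ∧ 2 ∣ s] · (ω(−1)ω(e_C), ω(e_C), 0)_i ∕ 2 · q^{s∕2}`

Cell `hodgecm-mathlib` (D-0151), FLOOR 0, crux item H413 = `stmt-HodgeConjecture-24833`, route `HCCMUnconditional`; squad F0∕P3c∕LH4.  THEOREMS ONLY (no `def`, no instance, no
notation, no `sorry`, default heartbeats); ★-only imports; lane `--supports stmt-HodgeConjecture-24833 --as helper` (count-neutral); pays NO row, states NO law.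
THE MATHEMATICS (SIG-PureCells v1 §1 row T₃; LH4-p05 (g8)'s box currency).  On `M₃(2j,x) = latt (1 0 0; x ϖ^{2j} 0; 0 0 1)` (plane `⟨e₀,e₁⟩` at distance `2j`, `e₂` split off) LH4-p04's
explicit polarisation is `D₁ = (−xσx·π₀^{−j}, π₀^{−j}, 1)`, so the top value of the label form at `D₁·u` (`u ∈ S_F = {|u₁ − u₀| ≤ |ϖ|^{2j}}`, ★ B4) is
`xσx·π₀^{−j}·(u₁(β−1) − u₀(α−1)) = xσx·π₀^{−j}·(u₀(β−α) + (u₁−u₀)(β−1))`, of valuation `|ϖ|^{ℓ₀}` on the read `2j + ℓ₀ = n₃` and `ϖ^{m*}`-congruent to `u₀·xσx·e_C·t₊` for the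
TOWER-SIGN TOKEN `e_C` of `β − α` (`|(ϖ^{m*})⁻¹((β−α)·π₀^{−j} − e_C·t₊)| ≤ 1`).  LH4-p13's ★ top-A read `valueClassLabel_latt_hnf_iff_normSign` therefore gives the ONE-SLOT shape
`Λ M (D₁·u) ↔ ω(e_C)·ω(u₀) = 1`, and F0P3-p01's ★ p860757 abstract heads with LH4-p04's ★ `kappaCount_zero_latt_axis3` (`κ₂ = ω(−1)[d ≤ j]`, `κ₁ = 0`) read the per-lattice value
`(ω(−1)ω(e_C), ω(e_C)·[d ≤ j], 0)_i ∕ 2 · stabiliserWeight`; the three shell tokens read `s + ℓ₀ = n₃` on the stratum (★ p859094; square token automatic), ★ p856661 counts `q^{s∕2}`.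
A TOKEN-FREE twin gives `0` off the read.  HONEST LABEL: count-neutral; SIG-B2b3, (β-BAL), (β), T₊ OPEN; `HC_CM` is proved only modulo the 7 printed citations (2 remaining named
inputs: hLiu418 = `stmt-HodgeConjecture-24832`, h413 = `stmt-HodgeConjecture-24833`) until rung 0 closes.
References: [Kottwitz1986BaseChangeUnits] §1 pp. 240–241 · [Rogawski1990] §4.9 Prop. 4.9.1 (a)(b) p. 55, §4.10 p. 58 · [LanglandsShelstad1987] §3 · [Serre1979] Ch. V §3 Cor. 3.
-/

set_option autoImplicit false

noncomputable section

namespace Summit.HodgeConjecture.HodgeConjecture.Cruxes.H413.F0P3cDyRamLabelledOddPureStrataT3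

open Literature.NumberTheory.Automorphic Literature.NumberTheory.Automorphic.HermitianLattice
open Literature.NumberTheory.Automorphic.UnitaryLatticeTree Literature.NumberTheory.Automorphic.UnitaryThreeFourFrame
open Literature.NumberTheory.LocalFields Literature.NumberTheory.LocalFields.WildQuadraticDatum
open Summit.HodgeConjecture.HodgeConjecture.Cruxes.H413.F0P3cDyRamFourFramePieces
open Summit.HodgeConjecture.HodgeConjecture.Cruxes.H413.F0P3cDyRamFourFrameCensusDefs
open Summit.HodgeConjecture.HodgeConjecture.Cruxes.H413.F0P3cDyRamStageOneBDefs (mcOfRecord)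
open Summit.HodgeConjecture.HodgeConjecture.Cruxes.H413.F0P3cDyRamDiagonalTorusDefs
open Summit.HodgeConjecture.HodgeConjecture.Cruxes.H413.F0P3cDyRamDiagonalStrataDefs
open Summit.HodgeConjecture.HodgeConjecture.Cruxes.H413.F0P3cDyRamDiagonalKappaCountDefs
open Summit.HodgeConjecture.HodgeConjecture.Cruxes.H413.F0P3cDyRamLabelledOddCountDefs
open Summit.HodgeConjecture.HodgeConjecture.Cruxes.H413.F0P3cDyRamStableSumSignClasses (normSign_eq_one_or)
open Summit.HodgeConjecture.HodgeConjecture.Cruxes.H413.F0P3cDyRamFixedCountDiagonalModel (normSign_mul_norm)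
open Summit.HodgeConjecture.HodgeConjecture.Cruxes.H413.F0P3cDyRamDiagonalOrbitFibreTransport (fibre_isCoset_zero)
open Summit.HodgeConjecture.HodgeConjecture.Cruxes.H413.F0P3cDyRamDiagonalSplitCount
open Summit.HodgeConjecture.HodgeConjecture.Cruxes.H413.F0P3cDyRamDiagonalSplitCountSockets
open Summit.HodgeConjecture.HodgeConjecture.Cruxes.H413.F0P3cDyRamDiagonalKappaSplitCountEval (isVertexLattice_latt_axis3 normSign_mul_self)
open Summit.HodgeConjecture.HodgeConjecture.Cruxes.H413.F0P3cDyRamDiagonalKappaSplitCountValues (kappaCount_zero_latt_axis3)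
open Summit.HodgeConjecture.HodgeConjecture.Cruxes.H413.F0P3cDyRamDiagonalKappaSplitCountSockets (finsum_kappaCount_mul_stabiliserWeight_hasAxis_T3)
open Summit.HodgeConjecture.HodgeConjecture.Cruxes.H413.F0P3cDyRamLabelledSplitStrata
open Summit.HodgeConjecture.HodgeConjecture.Cruxes.H413.F0P3cDyRamLabelledKappaSplitStrata (v_le_pow_iff_of_eq v_mul_self_le_pow_iff_of_eq)
open Summit.HodgeConjecture.HodgeConjecture.Cruxes.H413.F0P3cDyRamStableCountTypeZero (v_diag_eq_one diag_regular)
open Summit.HodgeConjecture.HodgeConjecture.Cruxes.H413.F0P3cDyRamDiagonalOrbitFibreCountHeads (finite_unitTorus_orbit_of_mem_normalisedStableLattices)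
open Summit.HodgeConjecture.HodgeConjecture.Cruxes.H413.F0P3cDyRamTwoSlotLabelRead (valueClassLabel_latt_hnf_iff_normSign)
open Summit.HodgeConjecture.HodgeConjecture.Cruxes.H413.F0P3cDyRamLabelledOddOneSlotKappa
open scoped Valued WithZero Matrix MatrixGroups

variable {K : Type} [Field K] [Valued K ℤᵐ⁰] [CompleteSpace K] [Fintype 𝓀[K]] {σ : K →+* K} {ϖ : K} {d t : ℕ} {α β : K} {N₀ n₁ n₂ n₃ : ℕ}

/-! ## §1  Per lattice: the value on `M₃(2j, x)` at the element letters -/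

/-- **PER-LATTICE VALUE ON `M₃(2j,x)`** (`|x| = 1`; element datum at `N₀ ≥ mcOfRecord d`, `2 ≤ d`; `M₃` is `T`-stable and on the clean shell; `e_C` a σ-fixed unit with
`|(ϖ^{m*})⁻¹((β−α)·π₀^{−j} − e_C·t₊)| ≤ 1`, `2j + ℓ₀ = n₃`): `labelledOddCount σ ϖ 0 i Λ M₃ ∕ [𝒰 : N(S̃′)] = (ω(−1)ω(e_C), ω(e_C)·[d ≤ j], 0)_i ∕ 2 · stabiliserWeight σ M₃` for
`Λ = valueClassLabel σ ϖ (α−1) (β−1) m* d` (★ p13 top-A read ⇒ one-slot shape in slot `0`; ★ p860757 heads; ★ `kappaCount_zero_latt_axis3`). [cite: Kottwitz1986BaseChangeUnits, §1 pp. 240–241]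
[cite: Rogawski1990, §4.9 Prop. 4.9.1 (a)(b) p. 55, §4.10 p. 58] [cite: LanglandsShelstad1987, §3] [cite: Serre1979, Ch. V §3 Cor. 3] -/
theorem labelledOddCount_div_relIndex_latt_axis3 (hD : IsRamifiedQuadraticDatum σ ϖ d t) (h2d : 2 ≤ d)
    (hE : IsElementDatum σ ϖ N₀ α β n₁ n₂ n₃) (hmc : mcOfRecord d ≤ N₀)
    (T : GL (Fin 3) K) (hT : (T : Matrix (Fin 3) (Fin 3) K) = Matrix.diagonal ![α, β, 1]) {x : K} (hx : Valued.v x = 1) (j : ℕ) (hjn : 2 * j + d % 2 = n₃)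
    {M₀ : Submodule 𝒪[K] (Fin 3 → K)} (hM₀ : M₀ = latt (!![1, 0, 0; x, ϖ ^ (2 * j), 0; 0, 0, 1] : Matrix (Fin 3) (Fin 3) K)) (hTM : mapGL T M₀ = M₀)
    (hlev : LatticeInLevel ϖ (d % 2) (Matrix.diagonal ![α - 1, β - 1, 0]) M₀) (hnlev : ¬ LatticeInLevel ϖ (d % 2 + 1) (Matrix.diagonal ![α - 1, β - 1, 0]) M₀)
    (hsq : LatticeInLevel ϖ (mcOfRecord d) (Matrix.diagonal ![(α - 1) * (α - 1), (β - 1) * (β - 1), 0]) M₀)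
    (hfin : {M : Submodule 𝒪[K] (Fin 3 → K) | ∃ u ∈ unitTorus K 3, M = mapGL (diagGLUnits u) M₀}.Finite)
    {eC : K} (hσeC : σ eC = eC) (heC1 : Valued.v eC = 1)
    (heC : Valued.v ((ϖ ^ (d % 2 + 2 * d - 1))⁻¹ * ((β - α) * ((ϖ * σ ϖ) ^ j)⁻¹ - eC * ((ϖ - σ ϖ) * ((ϖ * σ ϖ) ^ ((d - d % 2) / 2))⁻¹))) ≤ 1) (i : Fin 3) :
    (labelledOddCount σ ϖ 0 i (valueClassLabel σ ϖ (α - 1) (β - 1) (d % 2 + 2 * d - 1) d) M₀ : ℚ) /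
        ((((unitStabilizer M₀).map (unitNormMap σ 3)).relIndex (fixedUnitTorus σ 3) : ℕ) : ℚ) =
      ((if i = 0 then normSign σ (-1 : K) * normSign σ eC else if i = 1 ∧ d ≤ j then normSign σ eC else 0 : ℤ) : ℚ) / 2 * stabiliserWeight σ M₀ := by
  have hD' := hD
  obtain ⟨hσ, hvσ, hϖ, -, -, -, -⟩ := hD'
  haveI : IsAdicComplete 𝓂[K] 𝒪[K] := isAdicComplete_valuedInteger_of_completeSpace hϖ
  haveI : Finite 𝓀[K] := Finite.of_fintype _
  obtain ⟨c, hσc, hcv, hc, hdich⟩ := exists_nonnorm_dichotomy_of_isRamifiedQuadraticDatum σ ϖ d t hD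
  have hϖ0 : ϖ ≠ 0 := fun h0 => by rw [h0, map_zero] at hϖ; exact WithZero.coe_ne_zero hϖ.symm
  have hϖ1 : Valued.v ϖ ≤ 1 := by rw [hϖ, ← WithZero.exp_zero, WithZero.exp_le_exp]; norm_num
  have hσϖ0 : σ ϖ ≠ 0 := (map_ne_zero σ).2 hϖ0
  have hx0 : x ≠ 0 := fun h => by rw [h, map_zero] at hx; exact zero_ne_one hx
  have heC0 : eC ≠ 0 := fun h => by rw [h, map_zero] at heC1; exact zero_ne_one heC1
  have hπ₀σ : σ (ϖ * σ ϖ) = ϖ * σ ϖ := by rw [map_mul, hσ, mul_comm]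
  have hd₁σ : σ (((ϖ * σ ϖ) ^ j)⁻¹) = ((ϖ * σ ϖ) ^ j)⁻¹ := by rw [map_inv₀, map_pow, hπ₀σ]
  have hπ0 : ((ϖ * σ ϖ) ^ j : K) ≠ 0 := pow_ne_zero _ (mul_ne_zero hϖ0 hσϖ0)
  have hd₁0 : (((ϖ * σ ϖ) ^ j)⁻¹ : K) ≠ 0 := inv_ne_zero hπ0
  have hα : Valued.v (α - 1) = Valued.v ϖ ^ n₂ := hE.2.2.2.2.2.2.1
  have hβ : Valued.v (β - 1) = Valued.v ϖ ^ n₁ := hE.2.2.2.2.2.1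
  have hγ : Valued.v (α - β) = Valued.v ϖ ^ n₃ := hE.2.2.2.2.2.2.2.1
  have hn₁ : N₀ ≤ n₁ := hE.2.2.2.2.2.2.2.2.1
  have hn₂ : N₀ ≤ n₂ := hE.2.2.2.2.2.2.2.2.2.1
  have hn₃ : N₀ ≤ n₃ := hE.2.2.2.2.2.2.2.2.2.2
  have hmcv : mcOfRecord d = 2 * ((d % 2 + 2 * d - 1 + d) / 2) := rfl
  have hpw : ∀ a b : ℕ, Valued.v ϖ ^ a ≤ Valued.v ϖ ^ b ↔ b ≤ a := fun a b => by
    rw [v_varpi_pow hϖ, v_varpi_pow hϖ, WithZero.exp_le_exp]; omega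
  -- LH4-p04's explicit polarisation
  have hD₁ : ∀ k : Fin 3, σ ((![-(σ x * ((ϖ * σ ϖ) ^ j)⁻¹ * x), ((ϖ * σ ϖ) ^ j)⁻¹, 1] : Fin 3 → K) k) =
      (![-(σ x * ((ϖ * σ ϖ) ^ j)⁻¹ * x), ((ϖ * σ ϖ) ^ j)⁻¹, 1] : Fin 3 → K) k ∧ (![-(σ x * ((ϖ * σ ϖ) ^ j)⁻¹ * x), ((ϖ * σ ϖ) ^ j)⁻¹, 1] : Fin 3 → K) k ≠ 0 := by
    intro k
    fin_cases k
    · refine ⟨?_, ?_⟩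
      · show σ (-(σ x * ((ϖ * σ ϖ) ^ j)⁻¹ * x)) = -(σ x * ((ϖ * σ ϖ) ^ j)⁻¹ * x)
        rw [map_neg, map_mul, map_mul, hσ, hd₁σ]; ring
      · show -(σ x * ((ϖ * σ ϖ) ^ j)⁻¹ * x) ≠ 0
        exact neg_ne_zero.2 (mul_ne_zero (mul_ne_zero ((map_ne_zero σ).2 hx0) hd₁0) hx0)
    · exact ⟨hd₁σ, hd₁0⟩
    · exact ⟨map_one σ, one_ne_zero⟩
  have hV₁ := isVertexLattice_latt_axis3 hvσ hϖ hx j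
  have hnorm := isNormalisedLattice_latt_axis3 hϖ1 hx (2 * j)
  rw [← hM₀] at hV₁ hnorm
  have hcoset := fibre_isCoset_zero hvσ ϖ (Matrix.GeneralLinearGroup.mkOfDetNeZero _ (det_axis3_ne_zero hϖ0 x (2 * j))) hM₀ hnorm _ hD₁ hV₁
  have hSF : ∀ u : Fin 3 → Kˣ, u ∈ fixedUnitStabilizer σ M₀ ↔ u ∈ fixedUnitTorus σ 3 ∧ Valued.v ((u 1 : K) - u 0) ≤ Valued.v (ϖ ^ (2 * j)) := fun u => by
    rw [hM₀]; exact mem_fixedUnitStabilizer_latt_axis3_iff σ hϖ0 hx (2 * j) u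
  -- the HNF spelling of p13's read
  have hform : (!![1, 0, 0; x, ϖ ^ (2 * j), 0; 0, 0, 1] : Matrix (Fin 3) (Fin 3) K) = Matrix.of ![![1, 0, 0], ![x, ϖ ^ (2 * j), 0], ![(0 : K), 0, ϖ ^ 0]] := by
    rw [pow_zero]
  -- THE ONE-SLOT SHAPE of the label on the fibre `D₁·S_F`, with `ε = ω(e_C)`
  have hΛ : ∀ u ∈ fixedUnitStabilizer σ M₀,
      valueClassLabel σ ϖ (α - 1) (β - 1) (d % 2 + 2 * d - 1) d M₀
          (fun k => (![-(σ x * ((ϖ * σ ϖ) ^ j)⁻¹ * x), ((ϖ * σ ϖ) ^ j)⁻¹, 1] : Fin 3 → K) k * ((u k : Kˣ) : K)) ↔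
        normSign σ eC * normSign σ ((u 0 : Kˣ) : K) = 1 := by
    intro u hu
    obtain ⟨huT, h10⟩ := (hSF u).1 hu
    obtain ⟨huv, huσ⟩ := (mem_fixedUnitTorus_iff σ u).1 huT
    have hDuσ : ∀ k, σ ((![-(σ x * ((ϖ * σ ϖ) ^ j)⁻¹ * x), ((ϖ * σ ϖ) ^ j)⁻¹, 1] : Fin 3 → K) k * ((u k : Kˣ) : K)) =
        (![-(σ x * ((ϖ * σ ϖ) ^ j)⁻¹ * x), ((ϖ * σ ϖ) ^ j)⁻¹, 1] : Fin 3 → K) k * ((u k : Kˣ) : K) := fun k => by rw [map_mul, (hD₁ k).1, huσ k]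
    have hDu0 : ∀ k, (![-(σ x * ((ϖ * σ ϖ) ^ j)⁻¹ * x), ((ϖ * σ ϖ) ^ j)⁻¹, 1] : Fin 3 → K) k * ((u k : Kˣ) : K) ≠ 0 := fun k => mul_ne_zero (hD₁ k).2 (u k).ne_zero
    have hVu : IsVertexLattice σ ϖ (Matrix.diagonal fun k => (![-(σ x * ((ϖ * σ ϖ) ^ j)⁻¹ * x), ((ϖ * σ ϖ) ^ j)⁻¹, 1] : Fin 3 → K) k * ((u k : Kˣ) : K)) 0 M₀ :=
      (hcoset _ fun k => ⟨hDuσ k, hDu0 k⟩).2 ⟨u, hu, fun k => rfl⟩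
    -- the top value `S = xσx·π₀^{−j}·(u₀(β−α) + (u₁−u₀)(β−1))`
    have hS : (![-(σ x * ((ϖ * σ ϖ) ^ j)⁻¹ * x), ((ϖ * σ ϖ) ^ j)⁻¹, 1] : Fin 3 → K) 0 * ((u 0 : Kˣ) : K) * (α - 1) +
        (![-(σ x * ((ϖ * σ ϖ) ^ j)⁻¹ * x), ((ϖ * σ ϖ) ^ j)⁻¹, 1] : Fin 3 → K) 1 * ((u 1 : Kˣ) : K) * σ x * ((β - 1) * x) =
          x * σ x * ((ϖ * σ ϖ) ^ j)⁻¹ * (((u 0 : Kˣ) : K) * (β - α) + (((u 1 : Kˣ) : K) - (u 0 : Kˣ)) * (β - 1)) := by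
      simp only [Matrix.cons_val_zero, Matrix.cons_val_one]; ring
    have hvin : Valued.v (((u 0 : Kˣ) : K) * (β - α) + (((u 1 : Kˣ) : K) - (u 0 : Kˣ)) * (β - 1)) = Valued.v ϖ ^ n₃ := by
      have h1 : Valued.v (((u 0 : Kˣ) : K) * (β - α)) = Valued.v ϖ ^ n₃ := by rw [map_mul, huv 0, one_mul, Valuation.map_sub_swap, hγ]
      have h2 : Valued.v ((((u 1 : Kˣ) : K) - (u 0 : Kˣ)) * (β - 1)) < Valued.v ϖ ^ n₃ := by
        rw [map_mul, hβ]
        calc Valued.v (((u 1 : Kˣ) : K) - (u 0 : Kˣ)) * Valued.v ϖ ^ n₁ ≤ Valued.v (ϖ ^ (2 * j)) * Valued.v ϖ ^ n₁ := by gcongr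
          _ = Valued.v ϖ ^ (2 * j + n₁) := by rw [map_pow, pow_add]
          _ < Valued.v ϖ ^ n₃ := by
            rw [v_varpi_pow hϖ, v_varpi_pow hϖ, WithZero.exp_lt_exp]; omega
      rw [Valuation.map_add_eq_of_lt_left _ (by rw [h1]; exact h2), h1]
    have hxN : Valued.v (x * σ x * ((ϖ * σ ϖ) ^ j)⁻¹) = (Valued.v ϖ ^ (2 * j))⁻¹ := by
      rw [map_mul, map_mul, hvσ, hx, one_mul, one_mul, map_inv₀, map_pow, map_mul, hvσ, ← pow_two, ← pow_mul, mul_comm 2 j]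
    have hA : Valued.v ((![-(σ x * ((ϖ * σ ϖ) ^ j)⁻¹ * x), ((ϖ * σ ϖ) ^ j)⁻¹, 1] : Fin 3 → K) 0 * ((u 0 : Kˣ) : K) * (α - 1) +
        (![-(σ x * ((ϖ * σ ϖ) ^ j)⁻¹ * x), ((ϖ * σ ϖ) ^ j)⁻¹, 1] : Fin 3 → K) 1 * ((u 1 : Kˣ) : K) * σ x * ((β - 1) * x)) = Valued.v (ϖ ^ (d % 2)) := by
      rw [hS, map_mul, hxN, hvin, map_pow, v_varpi_pow hϖ, v_varpi_pow hϖ, v_varpi_pow hϖ, ← WithZero.exp_neg, ← WithZero.exp_add]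
      congr 1; push_cast; omega
    -- the congruence `S ≡ u₀·xσx·e_C·t₊ (mod ϖ^{m*})`
    have hm0 : Valued.v (ϖ ^ (d % 2 + 2 * d - 1)) ≠ 0 := (Valuation.ne_zero_iff _).2 (pow_ne_zero _ hϖ0)
    have hG : Valued.v ((ϖ ^ (d % 2 + 2 * d - 1))⁻¹ *
        ((![-(σ x * ((ϖ * σ ϖ) ^ j)⁻¹ * x), ((ϖ * σ ϖ) ^ j)⁻¹, 1] : Fin 3 → K) 0 * ((u 0 : Kˣ) : K) * (α - 1) +
          (![-(σ x * ((ϖ * σ ϖ) ^ j)⁻¹ * x), ((ϖ * σ ϖ) ^ j)⁻¹, 1] : Fin 3 → K) 1 * ((u 1 : Kˣ) : K) * σ x * ((β - 1) * x) -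
            ((u 0 : Kˣ) : K) * (x * σ x) * eC * ((ϖ - σ ϖ) * ((ϖ * σ ϖ) ^ ((d - d % 2) / 2))⁻¹))) ≤ 1 := by
      rw [hS, show x * σ x * ((ϖ * σ ϖ) ^ j)⁻¹ * (((u 0 : Kˣ) : K) * (β - α) + (((u 1 : Kˣ) : K) - (u 0 : Kˣ)) * (β - 1)) -
          ((u 0 : Kˣ) : K) * (x * σ x) * eC * ((ϖ - σ ϖ) * ((ϖ * σ ϖ) ^ ((d - d % 2) / 2))⁻¹) =
        x * σ x * (((u 0 : Kˣ) : K) * ((β - α) * ((ϖ * σ ϖ) ^ j)⁻¹ - eC * ((ϖ - σ ϖ) * ((ϖ * σ ϖ) ^ ((d - d % 2) / 2))⁻¹)) +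
          ((ϖ * σ ϖ) ^ j)⁻¹ * ((((u 1 : Kˣ) : K) - (u 0 : Kˣ)) * (β - 1))) by ring, ← mul_assoc,
        show (ϖ ^ (d % 2 + 2 * d - 1))⁻¹ * (x * σ x) = (x * σ x) * (ϖ ^ (d % 2 + 2 * d - 1))⁻¹ by ring, mul_assoc, map_mul, map_mul, hvσ, hx, one_mul, one_mul, mul_add]
      refine (Valuation.map_add _ _ _).trans (max_le ?_ ?_)
      · rw [← mul_assoc, show (ϖ ^ (d % 2 + 2 * d - 1))⁻¹ * ((u 0 : Kˣ) : K) = ((u 0 : Kˣ) : K) * (ϖ ^ (d % 2 + 2 * d - 1))⁻¹ by ring, mul_assoc, map_mul, huv 0, one_mul]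
        exact heC
      · have hp2j : Valued.v (ϖ ^ (2 * j)) ≠ 0 := (Valuation.ne_zero_iff _).2 (pow_ne_zero _ hϖ0)
        have hπv : Valued.v (((ϖ * σ ϖ) ^ j)⁻¹ : K) = (Valued.v (ϖ ^ (2 * j)))⁻¹ := by
          rw [map_inv₀, map_pow, map_mul, hvσ, ← pow_two, ← pow_mul, map_pow, mul_comm 2 j]
        have hβm : Valued.v (β - 1) ≤ Valued.v (ϖ ^ (d % 2 + 2 * d - 1)) := by rw [hβ, map_pow, hpw]; omega
        rw [map_mul, map_inv₀, map_mul, hπv, map_mul]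
        calc (Valued.v (ϖ ^ (d % 2 + 2 * d - 1)))⁻¹ * ((Valued.v (ϖ ^ (2 * j)))⁻¹ * (Valued.v (((u 1 : Kˣ) : K) - (u 0 : Kˣ)) * Valued.v (β - 1)))
            ≤ (Valued.v (ϖ ^ (d % 2 + 2 * d - 1)))⁻¹ * ((Valued.v (ϖ ^ (2 * j)))⁻¹ * (Valued.v (ϖ ^ (2 * j)) * Valued.v (ϖ ^ (d % 2 + 2 * d - 1)))) := by
              gcongr
          _ = 1 := by rw [← mul_assoc (Valued.v (ϖ ^ (2 * j)))⁻¹, inv_mul_cancel₀ hp2j, one_mul, inv_mul_cancel₀ hm0]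
    have hσG : σ (((u 0 : Kˣ) : K) * (x * σ x) * eC) = ((u 0 : Kˣ) : K) * (x * σ x) * eC := by
      rw [map_mul, map_mul, map_mul, huσ 0, hσ, hσeC]; ring
    have hread := valueClassLabel_latt_hnf_iff_normSign hD hDuσ hDu0 (b := 2 * j) (c := 0) (y := 0) (z := 0) hx.le (by rw [map_zero]; exact zero_le)
      (by rw [map_zero]; exact zero_le) (by rw [← hform, ← hM₀]; exact hnorm) (by rw [← hform, ← hM₀]; exact hVu) hE (mc := mcOfRecord d)
      (by omega) (by omega) (by rw [hmcv]; omega) (by rw [hmcv]; omega)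
      (by rw [← hform, ← hM₀]; exact hlev) (by rw [← hform, ← hM₀]; exact hnlev) (by rw [← hform, ← hM₀]; exact hsq) hT (by rw [← hform, ← hM₀]; exact hTM) hA hσG hG
    rw [← hform, ← hM₀] at hread
    rw [hread, show ((u 0 : Kˣ) : K) * (x * σ x) * eC = (((u 0 : Kˣ) : K) * eC) * (x * σ x) by ring, normSign_mul_norm σ _ hx0,
      normSign_mul_of_dichotomy σ hσc hc hdich (huσ 0) hσeC (u 0).ne_zero heC0, mul_comm]
  -- the two heads of ★ p860757 and LH4-p04's κ-values
  have hε : (normSign σ eC : ℤ) = 1 ∨ (normSign σ eC : ℤ) = -1 := normSign_eq_one_or σ eC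
  have hωD0 : normSign σ ((![-(σ x * ((ϖ * σ ϖ) ^ j)⁻¹ * x), ((ϖ * σ ϖ) ^ j)⁻¹, 1] : Fin 3 → K) 0) = normSign σ (-1 : K) :=
    F0P3cDyRamDiagonalKappaSplitCountEval.normSign_neg_polarisation_entry hϖ0 hx0 j
  have hκ : ∀ m : Fin 3, kappaCount σ ϖ 0 m M₀ = if m = 2 ∧ 2 * d ≤ 2 * j then normSign σ (-1 : K) else 0 := fun m => by
    rw [hM₀]; exact kappaCount_zero_latt_axis3 hD hx (Dvd.intro j rfl) m
  have hωm1 : (normSign σ (-1 : K) : ℚ) * (normSign σ (-1 : K) : ℚ) = 1 := by exact_mod_cast normSign_mul_self σ (-1 : K)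
  by_cases hi0 : i = 0
  · subst hi0
    rw [labelledOddCount_div_relIndex_eq_of_oneSlot_same hσ hvσ hσc hcv hc hdich hfin hD₁ hV₁ hcoset _ 0 hε hΛ, hωD0]
    simp only [if_true]; push_cast; ring
  by_cases hi1 : i = 1
  · subst hi1
    rw [labelledOddCount_div_relIndex_eq_kappaCount_mul_of_oneSlot hσ hvσ hσc hcv hc hdich hfin hD₁ hV₁ hcoset _ (i := 1) (k := 0) (m := 2)
      (by decide) (by decide) (by decide) hε hΛ, hωD0, hκ 2]
    by_cases hdj : d ≤ j
    · rw [if_pos (show (2 : Fin 3) = 2 ∧ 2 * d ≤ 2 * j from ⟨rfl, by omega⟩), if_neg (show (1 : Fin 3) ≠ 0 by decide), if_pos ⟨rfl, hdj⟩]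
      linear_combination ((normSign σ eC : ℚ) / 2 * stabiliserWeight σ M₀) * hωm1
    · rw [if_neg (fun h : (2 : Fin 3) = 2 ∧ 2 * d ≤ 2 * j => hdj (by omega)), if_neg (show (1 : Fin 3) ≠ 0 by decide), if_neg (fun h => hdj h.2)]
      push_cast; ring
  · obtain rfl : i = 2 := by
      fin_cases i
      · exact absurd rfl hi0
      · exact absurd rfl hi1
      · rfl
    rw [labelledOddCount_div_relIndex_eq_kappaCount_mul_of_oneSlot hσ hvσ hσc hcv hc hdich hfin hD₁ hV₁ hcoset _ (i := 2) (k := 0) (m := 1)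
      (by decide) (by decide) (by decide) hε hΛ, hκ 1, if_neg (fun h : (1 : Fin 3) = 2 ∧ 2 * d ≤ 2 * j => absurd h.1 (by decide)),
      if_neg (show (2 : Fin 3) ≠ 0 by decide), if_neg (fun h : (2 : Fin 3) = 1 ∧ d ≤ j => absurd h.1 (by decide))]
    push_cast; ring

/-! ## §2  Per stratum, in LH4-p05 (g8)'s box currency: `T₃ = (s,s,0)` cut by the clean shell of `X = diag(α−1, β−1, 0)` -/

omit [CompleteSpace K] [Fintype 𝓀[K]] in
/-- **THE CLEAN-SHELL READ ON `T₃ = (s,s,0)`** (token-free): for every member of the stratum the three shell tokens hold iff `s + ℓ₀ = n₃` (★ p859094 T₃ reads at the element letters;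
the square token's letter `|(β−1)² − (α−1)²| = |β−α|·|α+β−2| ≤ |ϖ|^{n₃+N₀}` is automatic). [cite: Kottwitz1986BaseChangeUnits, §1 pp. 240–241] [cite: Rogawski1990, §4.9 Prop. 4.9.1 (a) p. 55] -/
theorem shell_iff_of_mem_stratum_T3 (hD : IsRamifiedQuadraticDatum σ ϖ d t) (h2d : 2 ≤ d)
    (hE : IsElementDatum σ ϖ N₀ α β n₁ n₂ n₃) (hmc : mcOfRecord d ≤ N₀) (T : GL (Fin 3) K) (s : ℕ) (hs : 1 ≤ s) :
    ∀ M ∈ stratum σ ϖ T ![s, s, 0],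
      (LatticeInLevel ϖ (d % 2) (Matrix.diagonal ![α - 1, β - 1, 0]) M ∧ ¬ LatticeInLevel ϖ (d % 2 + 1) (Matrix.diagonal ![α - 1, β - 1, 0]) M ∧
          LatticeInLevel ϖ (mcOfRecord d) (Matrix.diagonal ![(α - 1) * (α - 1), (β - 1) * (β - 1), 0]) M) ↔ s + d % 2 = n₃ := by
  classical
  have hD' := hD
  obtain ⟨hσ, hvσ, hϖ, hfix, -, -, -⟩ := hD'
  have hϖ0 : ϖ ≠ 0 := fun h0 => by rw [h0, map_zero] at hϖ; exact WithZero.coe_ne_zero hϖ.symm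
  have hα : Valued.v (α - 1) = Valued.v ϖ ^ n₂ := hE.2.2.2.2.2.2.1
  have hβ : Valued.v (β - 1) = Valued.v ϖ ^ n₁ := hE.2.2.2.2.2.1
  have hγ : Valued.v (α - β) = Valued.v ϖ ^ n₃ := hE.2.2.2.2.2.2.2.1
  have hn₁ : N₀ ≤ n₁ := hE.2.2.2.2.2.2.2.2.1
  have hn₂ : N₀ ≤ n₂ := hE.2.2.2.2.2.2.2.2.2.1
  have hn₃ : N₀ ≤ n₃ := hE.2.2.2.2.2.2.2.2.2.2
  have hγ' : Valued.v (β - 1 - (α - 1)) = Valued.v ϖ ^ n₃ := by rw [show β - 1 - (α - 1) = -(α - β) by ring, Valuation.map_neg, hγ]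
  have hmcv : mcOfRecord d = 2 * ((d % 2 + 2 * d - 1 + d) / 2) := rfl
  have hpw : ∀ a b : ℕ, Valued.v ϖ ^ a ≤ Valued.v ϖ ^ b ↔ b ≤ a := fun a b => by
    rw [v_varpi_pow hϖ, v_varpi_pow hϖ, WithZero.exp_le_exp]; omega
  have r1 := v_le_pow_iff_of_eq hD hα
  have r2 := v_le_pow_iff_of_eq hD hβ
  have r3 := v_le_pow_iff_of_eq hD hγ'
  have r1' := v_mul_self_le_pow_iff_of_eq hD hα
  have r2' := v_mul_self_le_pow_iff_of_eq hD hβ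
  have hv0 : ∀ ℓ : ℕ, Valued.v (0 : K) ≤ Valued.v ϖ ^ ℓ := fun ℓ => by rw [map_zero]; exact zero_le
  -- the square token's mixed letter, bounded once and for all
  have hsqd : Valued.v ((β - 1) * (β - 1) - (α - 1) * (α - 1)) ≤ Valued.v ϖ ^ (n₃ + N₀) := by
    rw [show (β - 1) * (β - 1) - (α - 1) * (α - 1) = (β - 1 - (α - 1)) * ((β - 1) + (α - 1)) by ring, map_mul, hγ', pow_add]
    gcongr
    refine (Valuation.map_add _ _ _).trans (max_le ?_ ?_)
    · rw [hβ, hpw]; omega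
    · rw [hα, hpw]; omega
  intro M hM
  obtain ⟨x, hx, rfl⟩ := (hasAxis_axis3_iff hϖ hM.1 hs).1 hM.2.2
  rw [latticeInLevel_diagonal_latt_T3_iff hϖ0 (d % 2) s _ hx, latticeInLevel_diagonal_latt_T3_iff hϖ0 (d % 2 + 1) s _ hx,
    latticeInLevel_diagonal_latt_T3_iff hϖ0 (mcOfRecord d) s _ hx]
  simp only [Matrix.cons_val_zero, Matrix.cons_val_one, Matrix.cons_val_two, Matrix.tail_cons, Matrix.head_cons, hv0, and_true, r1, r2, r3, r1', r2']
  rw [hmcv] at hmc ⊢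
  constructor
  · rintro ⟨⟨-, h1⟩, h2, -⟩; omega
  · intro h
    refine ⟨⟨⟨by omega, by omega⟩, by omega⟩, fun h' => by omega, ⟨by omega, by omega⟩, hsqd.trans ((hpw _ _).2 (by omega))⟩

omit [CompleteSpace K] [Fintype 𝓀[K]] in
/-- **`T₃ = (s,s,0)` OFF THE READ, TOKEN-FREE** (LH4-p05 (g8) parity ask): if `¬ (s + ℓ₀ = n₃ ∧ 2 ∣ s)` the clean-shell cut of the stratum `(s,s,0)` carries labelled odd value
`0` in every slot. [cite: Kottwitz1986BaseChangeUnits, §1 pp. 240–241] [cite: Rogawski1990, §4.9 Prop. 4.9.1 (a) p. 55] -/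
theorem finsum_stratum_T3_shell_labelledOdd_div_relIndex_eq_zero_of_not (hD : IsRamifiedQuadraticDatum σ ϖ d t) (h2d : 2 ≤ d)
    (hE : IsElementDatum σ ϖ N₀ α β n₁ n₂ n₃) (hmc : mcOfRecord d ≤ N₀)
    (T : GL (Fin 3) K) (s : ℕ) (hs : 1 ≤ s) (hnot : ¬ (s + d % 2 = n₃ ∧ 2 ∣ s)) (i : Fin 3) :
    ∑ᶠ M ∈ {M : Submodule 𝒪[K] (Fin 3 → K) | M ∈ stratum σ ϖ T ![s, s, 0] ∧
        (LatticeInLevel ϖ (d % 2) (Matrix.diagonal ![α - 1, β - 1, 0]) M ∧ ¬ LatticeInLevel ϖ (d % 2 + 1) (Matrix.diagonal ![α - 1, β - 1, 0]) M ∧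
          LatticeInLevel ϖ (mcOfRecord d) (Matrix.diagonal ![(α - 1) * (α - 1), (β - 1) * (β - 1), 0]) M)},
      (labelledOddCount σ ϖ 0 i (valueClassLabel σ ϖ (α - 1) (β - 1) (mstarOfRecord d) d) M : ℚ) /
        ((((unitStabilizer M).map (unitNormMap σ 3)).relIndex (fixedUnitTorus σ 3) : ℕ) : ℚ) = 0 := by
  classical
  have hD' := hD
  obtain ⟨hσ, hvσ, hϖ, hfix, -, -, -⟩ := hD'
  rw [finsum_mem_sep_eq_ite_of_forall_iff (stratum σ ϖ T ![s, s, 0]) _ _ (shell_iff_of_mem_stratum_T3 hD h2d hE hmc T s hs)]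
  by_cases hP : s + d % 2 = n₃
  · rw [if_pos hP]
    have h2s : ¬ 2 ∣ s := fun h => hnot ⟨hP, h⟩
    have hzero : ∀ M ∈ stratum σ ϖ T ![s, s, 0],
        (labelledOddCount σ ϖ 0 i (valueClassLabel σ ϖ (α - 1) (β - 1) (mstarOfRecord d) d) M : ℚ) /
            ((((unitStabilizer M).map (unitNormMap σ 3)).relIndex (fixedUnitTorus σ 3) : ℕ) : ℚ) = 0 := by
      intro M hM
      obtain ⟨x, hx, hMe⟩ := (hasAxis_axis3_iff hϖ hM.1 hs).1 hM.2.2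
      exact absurd (two_dvd_of_isDualisableLattice_latt_axis3 hvσ hfix hϖ hx (hMe ▸ hM.2.1)) h2s
    rw [finsum_mem_congr rfl hzero]
    simp
  · rw [if_neg hP]

/-- **THE `T₃ = (s,s,0)` STRATUM ON THE CLEAN SHELL** (`s ≥ 1`; `2 ≤ d`, `mcOfRecord d ≤ N₀`; `e_C` the tower-sign token of `β − α`):
`Σᶠ_{M ∈ stratum (s,s,0), shell} labelledOddCount σ ϖ 0 i Λ M ∕ [𝒰 : N(S̃′(M))] = [s + ℓ₀ = n₃ ∧ 2 ∣ s] · (ω(−1)ω(e_C), ω(e_C), 0)_i ∕ 2 · q^{s∕2}`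
(§1 per lattice behind the token-free read; ★ p856661 T₃ count `q^{s∕2}`). [cite: Kottwitz1986BaseChangeUnits, §1 pp. 240–241] [cite: Rogawski1990, §4.9 Prop. 4.9.1 (a)(b) p. 55, §4.10 p. 58]
[cite: LanglandsShelstad1987, §3] [cite: Serre1979, Ch. V §3 Cor. 3] -/
theorem finsum_stratum_T3_shell_labelledOdd_div_relIndex_eq (hD : IsRamifiedQuadraticDatum σ ϖ d t) (h2d : 2 ≤ d)
    (hE : IsElementDatum σ ϖ N₀ α β n₁ n₂ n₃) (hmc : mcOfRecord d ≤ N₀)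
    (T : GL (Fin 3) K) (hT : (T : Matrix (Fin 3) (Fin 3) K) = Matrix.diagonal ![α, β, 1]) (s : ℕ) (hs : 1 ≤ s)
    {eC : K} (hσeC : σ eC = eC) (heC1 : Valued.v eC = 1)
    (heC : Valued.v ((ϖ ^ mstarOfRecord d)⁻¹ * ((β - α) * ((ϖ * σ ϖ) ^ ((n₃ - d % 2) / 2))⁻¹ - eC * ((ϖ - σ ϖ) * ((ϖ * σ ϖ) ^ ((d - d % 2) / 2))⁻¹))) ≤ 1)
    (i : Fin 3) :
    ∑ᶠ M ∈ {M : Submodule 𝒪[K] (Fin 3 → K) | M ∈ stratum σ ϖ T ![s, s, 0] ∧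
        (LatticeInLevel ϖ (d % 2) (Matrix.diagonal ![α - 1, β - 1, 0]) M ∧ ¬ LatticeInLevel ϖ (d % 2 + 1) (Matrix.diagonal ![α - 1, β - 1, 0]) M ∧
          LatticeInLevel ϖ (mcOfRecord d) (Matrix.diagonal ![(α - 1) * (α - 1), (β - 1) * (β - 1), 0]) M)},
      (labelledOddCount σ ϖ 0 i (valueClassLabel σ ϖ (α - 1) (β - 1) (mstarOfRecord d) d) M : ℚ) /
        ((((unitStabilizer M).map (unitNormMap σ 3)).relIndex (fixedUnitTorus σ 3) : ℕ) : ℚ) =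
      if s + d % 2 = n₃ ∧ 2 ∣ s then
        ((if i = 0 then normSign σ (-1 : K) * normSign σ eC else if i = 1 then normSign σ eC else 0 : ℤ) : ℚ) / 2 * (Fintype.card 𝓀[K] : ℚ) ^ (s / 2)
      else 0 := by
  classical
  have hD' := hD
  obtain ⟨hσ, hvσ, hϖ, hfix, -, -, -⟩ := hD'
  have hn₃ : N₀ ≤ n₃ := hE.2.2.2.2.2.2.2.2.2.2
  have hmcv : mcOfRecord d = 2 * ((d % 2 + 2 * d - 1 + d) / 2) := rfl
  have hmsv : mstarOfRecord d = d % 2 + 2 * d - 1 := rfl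
  have hread := shell_iff_of_mem_stratum_T3 hD h2d hE hmc T s hs
  by_cases hcond : s + d % 2 = n₃ ∧ 2 ∣ s
  swap
  · rw [if_neg hcond]
    exact finsum_stratum_T3_shell_labelledOdd_div_relIndex_eq_zero_of_not hD h2d hE hmc T s hs hcond i
  obtain ⟨hP, ⟨j, hj⟩⟩ := hcond
  rw [if_pos (show s + d % 2 = n₃ ∧ 2 ∣ s from ⟨hP, Dvd.intro j hj.symm⟩), finsum_mem_sep_eq_ite_of_forall_iff (stratum σ ϖ T ![s, s, 0]) _ _ hread, if_pos hP]
  have hsv := v_diag_eq_one hvσ hE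
  have hreg := diag_regular hE
  have hjn : (n₃ - d % 2) / 2 = j := by omega
  rw [hjn] at heC
  have hdj : d ≤ j := by rw [hmcv] at hmc; omega
  have hval : ∀ M ∈ stratum σ ϖ T ![s, s, 0],
      (labelledOddCount σ ϖ 0 i (valueClassLabel σ ϖ (α - 1) (β - 1) (mstarOfRecord d) d) M : ℚ) /
          ((((unitStabilizer M).map (unitNormMap σ 3)).relIndex (fixedUnitTorus σ 3) : ℕ) : ℚ) =
        ((if i = 0 then normSign σ (-1 : K) * normSign σ eC else if i = 1 then normSign σ eC else 0 : ℤ) : ℚ) / 2 * stabiliserWeight σ M := by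
    intro M hM
    obtain ⟨htok, hntok, hsq⟩ := (hread M hM).2 hP
    obtain ⟨x, hx, hMe⟩ := (hasAxis_axis3_iff hϖ hM.1 hs).1 hM.2.2
    rw [hj] at hMe
    have h := labelledOddCount_div_relIndex_latt_axis3 hD h2d hE hmc T hT hx j (by omega) hMe hM.1.2.1 htok hntok hsq
      (finite_unitTorus_orbit_of_mem_normalisedStableLattices hϖ hsv hreg T hT hM.1) hσeC heC1 heC i
    rw [hmsv, h]
    simp only [hdj, and_true]
  rw [finsum_mem_congr rfl hval, ← mul_finsum_mem, finsum_stabiliserWeight_hasAxis_T3 hD hE hT s hs,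
    if_pos (show 2 ∣ s ∧ s ≤ n₃ from ⟨Dvd.intro j hj.symm, by omega⟩)]

end Summit.HodgeConjecture.HodgeConjecture.Cruxes.H413.F0P3cDyRamLabelledOddPureStrataT3

end
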